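import Mathlib

/-!
# Cross-intersecting families of pairs

A finite combinatorial lemma used as the engine of the structure theory for twisted (few-multiplier)
TPP realizations with fixed points (this work, §8.4b, Lemma X):

if `(F i)_{i}` and `(G k)_{k}` are families of sets of size `≤ 2` with `F i ∩ G k ≠ ∅` for all `i, k`
(and the index type of `G` is nonempty), then either the `G k` have a common element, or all `F i` lie
in one set of size `≤ 6`.

Application (§8.4b, structure lemma for multiplier group `{±1}`): for two columns `j ≠ j'` of the first
matrix of a twisted realization, `F i = {|a(i,j') - a(i,j)|, |a(i,j') + a(i,j)|}` and
`G k = {|b(j,k) + b(j',k)|, |b(j,k) - b(j',k)|}` (classes modulo sign) are cross-intersecting by the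
triangle equations, so either the two rows of `b` are twisted translates by a single shift, or the two
columns of `a` are plain translates up to twelve shifts. References: this work §8; CohnUmans2013
(arXiv:1207.6528) Def. 12 for the realizations.
-/

namespace Summit.MatrixMultiplication.MatrixMultiplication.Theorems.TwistedTPP

open Finset

/-- **Lemma X (cross-intersecting pairs).** Families of `≤ 2`-sets `F i`, `G k` with all
`F i ∩ G k` nonempty: either the `G k` share an element, or some `U` with `|U| ≤ 6` contains every
`F i`. [this work, §8.4b] -/
theorem cross_intersecting_pairs {α ι κ : Type*} [DecidableEq α] [Nonempty κ]
    (F : ι → Finset α) (G : κ → Finset α)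
    (hF : ∀ i, (F i).card ≤ 2) (hG : ∀ k, (G k).card ≤ 2)
    (hX : ∀ i k, (F i ∩ G k).Nonempty) :
    (∃ x, ∀ k, x ∈ G k) ∨ ∃ U : Finset α, U.card ≤ 6 ∧ ∀ i, F i ⊆ U := by
  classical
  by_cases h : ∃ x, ∀ k, x ∈ G k
  · exact Or.inl h
  right
  push Not at h
  -- for every `x` pick an index `kx x` with `x ∉ G (kx x)`
  choose kx hkx using h
  obtain ⟨k₁⟩ := ‹Nonempty κ›
  refine ⟨G k₁ ∪ (G k₁).biUnion (fun x => G (kx x)), ?_, ?_⟩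
  · calc (G k₁ ∪ (G k₁).biUnion (fun x => G (kx x))).card
          ≤ (G k₁).card + ((G k₁).biUnion (fun x => G (kx x))).card := card_union_le _ _
      _ ≤ (G k₁).card + ∑ x ∈ G k₁, (G (kx x)).card :=
          Nat.add_le_add_left card_biUnion_le _
      _ ≤ (G k₁).card + ∑ _x ∈ G k₁, 2 :=
          Nat.add_le_add_left (sum_le_sum fun x _ => hG (kx x)) _
      _ = (G k₁).card + (G k₁).card * 2 := by rw [sum_const, smul_eq_mul]
      _ ≤ 2 + 2 * 2 := by have := hG k₁; nlinarith
      _ = 6 := by norm_num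
  · intro i z hz
    rw [mem_union]
    by_cases hz1 : z ∈ G k₁
    · exact Or.inl hz1
    right
    obtain ⟨x, hx⟩ := hX i k₁
    rw [mem_inter] at hx
    have hxz : x ≠ z := by rintro rfl; exact hz1 hx.2
    obtain ⟨y, hy⟩ := hX i (kx x)
    rw [mem_inter] at hy
    have hyx : y ≠ x := by rintro rfl; exact hkx _ hy.2
    -- `F i` has at most two elements and contains `x ≠ z`; the element `y ≠ x` of `F i` is `z`.
    have hyz : y = z := by
      by_contra hyz
      have h3 : ({x, y, z} : Finset α) ⊆ F i := by
        intro w hw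
        simp only [mem_insert, mem_singleton] at hw
        rcases hw with rfl | rfl | rfl
        · exact hx.1
        · exact hy.1
        · exact hz
      have hcard : ({x, y, z} : Finset α).card = 3 := by
        rw [card_insert_of_notMem, card_insert_of_notMem, card_singleton]
        · simpa using hyz
        · simp only [mem_insert, mem_singleton, not_or]; exact ⟨hyx.symm, hxz⟩
      have := card_le_card h3
      have := hF i
      omega
    subst hyz
    exact mem_biUnion.mpr ⟨x, hx.2, hy.2⟩

/-- Symmetric form of `cross_intersecting_pairs`: either the `F i` share an element, or some `U` with
`|U| ≤ 6` contains every `G k`. [this work, §8.4b] -/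
theorem cross_intersecting_pairs' {α ι κ : Type*} [DecidableEq α] [Nonempty ι]
    (F : ι → Finset α) (G : κ → Finset α)
    (hF : ∀ i, (F i).card ≤ 2) (hG : ∀ k, (G k).card ≤ 2)
    (hX : ∀ i k, (F i ∩ G k).Nonempty) :
    (∃ x, ∀ i, x ∈ F i) ∨ ∃ U : Finset α, U.card ≤ 6 ∧ ∀ k, G k ⊆ U :=
  cross_intersecting_pairs G F hG hF (fun k i => by rw [inter_comm]; exact hX i k)

end Summit.MatrixMultiplication.MatrixMultiplication.Theorems.TwistedTPP
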